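import Literature.MathematicalPhysics.QuantumFieldTheory.Balaban1983to89.B11Eq129Minimizer
import Literature.MathematicalPhysics.QuantumFieldTheory.Balaban1983to89.B11Eq127EulerLagrange

/-!
# `Balaban1983to89.B11Eq110GreenInverse` — T. Bałaban, *The variational problem and background fields in renormalization group method
# for lattice gauge theories*, Commun. Math. Phys. **102** (1985) 277–309 [Balaban1985Variational], p. 294 *«We denote by G₁ an inverse
# operator to the operator Δ₁ + DRD* + aQ*Q»* ((110), (117)), p. 285 (45) *«The operators Δ, Q and R define the operator H»*, p. 293 (103)
# `H₁`: the Green operator `G₁`, the inverse `(QG₁Q*)⁻¹` and `H₁ = G₁Q*(QG₁Q*)⁻¹` CONSTRUCTED as linear maps on finite-dimensional real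
# Hilbert spaces from the displayed positivity of `Δ_{1,a}` ([B9] = [Balaban1985BackgroundPropagators] Theorem 3.11) and the injectivity of
# `Q*` (= `Q` onto, [B9] (3.19)), DISCHARGING the operator-data hypotheses `hΔG`, `hK` of `B11Eq129Minimizer` / `B11Eq101Translation`

statement-level skeleton of published theorems with citation tags; proofs where landed; nothing here is a claim
about the Yang–Mills mass gap

PDF held: `paper:balaban1985-cmp102-variational-background` (journal page = PDF page + 276); pp. 285, 293–295 (PDF 9, 17–19) read from the
held text by this seat (`lit read`, 2026-08-21); [B9] p. 416 Thm 3.11 quoted from the header of `B9Eq319Onto` / `B9Thm311Data`.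

THE PRINT (verbatim).  p. 285: *«The operators Δ, Q and R define the operator H. Let us recall that it is an operator defined on configurations
B and giving a minimum of the quadratic form ½⟨A, ΔA⟩ under the restrictions L^jηQ_jA = B on Λ_j, j = 0, 1, …, k, RD*A = 0. Thus it has the
following properties L^jηQ_jHB = B on Λ_j, RD*HB = 0, (45) and the Theorem 3.12 from [5] implies |HB| ≤ B₀(L^jη)⁻¹|B|, |∇HB| ≤ B₀(L^jη)⁻²|B| on
Ω_j. (46)»*  p. 293: *«We take the operators H₁, 𝔓 defined by the operator Δ₁. Let us recall that 𝔓 is an orthogonal projection in a space of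
configurations A′ with a scalar product defined by the operator Δ₁ + D*RD + aQ*Q, onto a subspace of A′ satisfying the conditions QA′ = 0,
RD*A′ = 0.»*  p. 294: *«We denote by G₁ an inverse operator to the operator Δ₁ + DRD* + aQ*Q. Obviously we have Δ₁A₁ = G₁⁻¹A₁ and Eq. (108)
implies A₁ + G₁J + G₁(δ/δA′)V(A₁ + H₁B) = 0. (110) In [5] we have proved that the operator G₁𝔓* is equal to the operator 𝔊 defined by (3.148)»*;
p. 295 (117): *«By Theorem 3.13 of [5] …»*.  [B9] p. 416, Theorem 3.11: *«the operators Δ′_a, G′, (Q′G′²Q′*)⁻¹, Δ_a, G are positive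
definite. This is obvious for the first three operators»*.

WHY THIS FILE (cell context).  lit-balaban's Sect. D files carry these operators as DATA with hypotheses: `B11Eq127EulerLagrange.laplaceA
Δ₁ D R D* Q Q* a` (= `Δ₁ + DRD* + Q*aQ`), `B11Eq129Minimizer.hOp G₁ Q* Kinv b` (= `H₁B`) with `hΔG : ∀ x, Δ(G₁x) = x`, `hK : ∀ y,
Q(G₁(Q*(Kinv y))) = y`, `hadj`, `hsymm`, `hpsd` (its header: *«existence of G₁, (QG₁Q*)⁻¹ … are hypotheses ([5] Sect. D, Thm 3.12–3.13)»*).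
THIS FILE constructs `G₁` and `(QG₁Q*)⁻¹` from the ONE displayed positivity statement (the content of [B9] Thm 3.11 for `Δ_{1,a}`) plus `Q*`
injective (`B9Eq319Onto`: `Q` onto ⟹ `Q*` injective), so that `hΔG` and `hK` hold BY CONSTRUCTION and `H₁` is an OBJECT determined by the
printed operators — letter (L6) of the pub-balaban NE9 letter map at the Hilbert-space level (the concrete carriers and `D`, `D*` are the
companion files `B9Eq311L2Pairing`, `B9Eq33CovDerivVector`; `Q`, `R`, `a`, `Δ′` remain data).

WHAT IS DEFINED AND PROVED (sorry-free; no `Prop` placeholder; no inequality of the paper).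
* §1 `green T hpos : E →ₗ[ℝ] E` — the inverse of a positive definite operator on a finite-dimensional real Hilbert space
  (`LinearEquiv.ofBijective`; `injective_of_posDef`, `bijective_of_posDef`); `apply_green` / `green_apply` / `comp_green` / `green_comp`,
  `green_injective`, **`inner_green_pos`** (the inverse is positive definite), `green_symm` (symmetric if `T` is).
* §2 `G1 Δ₁ D R D* Q Q* a hpos := green (laplaceA …)` with **`laplaceA_G1`** (= `hΔG`, discharged), `G1_laplaceA`, `inner_G1_pos`;
  **`inner_K_pos`** (`QG₁Q*` positive definite from `hadj` + `Q*` injective); `Kinv := green (Q ∘ G₁ ∘ Q*)`, **`hK_holds`** (= `hK`, discharged);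
  `H1 := G₁ ∘ Q* ∘ Kinv`, `H1_apply` (= `hOp …` by `rfl`), **`Q_H1`** ((45) first member `Q(H₁b) = b`, hypothesis-free), `H1_injective`,
  `laplaceA_H1` (`Δ_{1,a}H₁b = Q*(QG₁Q*)⁻¹b`), `inner_laplaceA_H1_eq_zero` («⟨δA′, Δ₁H₁B⟩ = 0» for `QδA′ = 0`, p. 293).

MODEL / DECLARED READINGS.  (M1) Abstract finite-dimensional REAL inner-product spaces `E` (configurations), `F` (block data), module `S`
(range of `D*`), exactly the typing of `B11Eq127EulerLagrange` / `B11Eq129Minimizer`; adjoints `D*`, `Q*` remain DATA here (they are genuine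
`LinearMap.adjoint`s on the concrete carriers of `B9Eq311L2Pairing`).  (M2) THE ONE ANALYTIC INPUT is `hpos : ∀ x ≠ 0, 0 < ⟨x, Δ_{1,a}x⟩`
— DISPLAYED, never asserted ([B9] Thm 3.11 is a `…Printed` statement of the tree); `hQadj` = `Q*` injective is [B9] (3.19)'s «Q′ onto»
(proved abstractly in `B9Eq319Onto`).  (M3) (45) second member `RD*HB = 0` and the bounds (46)/(103) are NOT derived here (they need the
variational characterisation with the `DRD*` weight resp. [B9] Thm 3.12 — T-rows).
HONEST SCOPE.  Finite-dimensional linear algebra ([folklore]) realising printed OPERATOR DEFINITIONS as objects and discharging two data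
hypotheses of the tree; no estimate of the paper; NOT summit progress (cell pub-balaban: NE9 NOT PRINTED / NOT PROVED; spine PROVED 0/9).
Filed by the pub-balaban NE9 BINDER-row owner lineage `b2b-balaban-t4-ne9-p1` (gen 76); a NEW file importing `B11Eq129Minimizer` and
`B11Eq127EulerLagrange` only; nothing of lit-balaban's is modified.  Net new unproved facts: 0.
-/

noncomputable section

open scoped InnerProductSpace

namespace Literature.MathematicalPhysics.QuantumFieldTheory.Balaban1983to89.B11Eq110GreenInverse

open B11Eq127EulerLagrange (laplaceA)
open B11Eq129Minimizer (hOp constraint_hOp)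

variable {E : Type*} [NormedAddCommGroup E] [InnerProductSpace ℝ E]

/-! ## §1 The inverse of a positive definite operator on a finite-dimensional Hilbert space -/

section Green

/-- A positive definite operator (`0 < ⟨x, Tx⟩` for `x ≠ 0`) is injective. [cite: Balaban1985BackgroundPropagators, Thm 3.11 p.416] -/
theorem injective_of_posDef {T : E →ₗ[ℝ] E} (hpos : ∀ x : E, x ≠ 0 → 0 < ⟪x, T x⟫_ℝ) : Function.Injective T := by
  rw [← LinearMap.ker_eq_bot, LinearMap.ker_eq_bot']
  intro x hx
  by_contra h
  have := hpos x h
  rw [hx, inner_zero_right] at this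
  exact lt_irrefl 0 this

variable [FiniteDimensional ℝ E]

/-- … hence bijective (finite dimension). [cite: Balaban1985BackgroundPropagators, Thm 3.11 p.416] -/
theorem bijective_of_posDef {T : E →ₗ[ℝ] E} (hpos : ∀ x : E, x ≠ 0 → 0 < ⟪x, T x⟫_ℝ) : Function.Bijective T :=
  ⟨injective_of_posDef hpos, LinearMap.surjective_of_injective (injective_of_posDef hpos)⟩

/-- **THE GREEN OPERATOR** `T⁻¹` of a positive definite operator `T` on a finite-dimensional real Hilbert space — the «inverse operator» by which
[B11] p. 294 introduces `G₁` (*«We denote by G₁ an inverse operator to the operator Δ₁ + DRD* + aQ*Q»*) and [B9] (3.122)/(3.128)–(3.129)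
`G`, `G₁`, CONSTRUCTED (`LinearEquiv.ofBijective`) from the positivity asserted by [B9] Theorem 3.11 (displayed as the hypothesis `hpos`,
never proved here). [cite: Balaban1985Variational, (110) p.294; Balaban1985BackgroundPropagators, Thm 3.11 p.416] -/
def green (T : E →ₗ[ℝ] E) (hpos : ∀ x : E, x ≠ 0 → 0 < ⟪x, T x⟫_ℝ) : E →ₗ[ℝ] E :=
  ((LinearEquiv.ofBijective T (bijective_of_posDef hpos)).symm : E ≃ₗ[ℝ] E)

variable {T : E →ₗ[ℝ] E} (hpos : ∀ x : E, x ≠ 0 → 0 < ⟪x, T x⟫_ℝ)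

/-- `T (T⁻¹ x) = x`. [cite: Balaban1985Variational, (110) p.294] -/
@[simp] theorem apply_green (x : E) : T (green T hpos x) = x :=
  (LinearEquiv.ofBijective T (bijective_of_posDef hpos)).apply_symm_apply x

/-- `T⁻¹ (T x) = x`. [cite: Balaban1985Variational, (110) p.294] -/
@[simp] theorem green_apply (x : E) : green T hpos (T x) = x :=
  (LinearEquiv.ofBijective T (bijective_of_posDef hpos)).symm_apply_apply x

/-- `T ∘ T⁻¹ = id`. [cite: Balaban1985Variational, (110) p.294] -/
theorem comp_green : T ∘ₗ green T hpos = LinearMap.id := LinearMap.ext (apply_green hpos)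

/-- `T⁻¹ ∘ T = id`. [cite: Balaban1985Variational, (110) p.294] -/
theorem green_comp : green T hpos ∘ₗ T = LinearMap.id := LinearMap.ext (green_apply hpos)

/-- `T⁻¹` is injective. [cite: Balaban1985Variational, (110) p.294] -/
theorem green_injective : Function.Injective (green T hpos) :=
  (LinearEquiv.ofBijective T (bijective_of_posDef hpos)).symm.injective

/-- **`T⁻¹` is positive definite**: `⟨x, T⁻¹x⟩ = ⟨Ty, y⟩ > 0` with `y = T⁻¹x ≠ 0` (no symmetry of `T` needed, real scalar product).
[cite: Balaban1985BackgroundPropagators, Thm 3.11 p.416] -/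
theorem inner_green_pos (x : E) (hx : x ≠ 0) : 0 < ⟪x, green T hpos x⟫_ℝ := by
  have hy : green T hpos x ≠ 0 := fun h => hx (by rw [← apply_green hpos x, h, map_zero])
  have h := hpos (green T hpos x) hy
  rwa [apply_green, real_inner_comm] at h

/-- `T⁻¹` is symmetric when `T` is. [cite: Balaban1985BackgroundPropagators, Thm 3.11 p.416] -/
theorem green_symm (hsymm : ∀ x y : E, ⟪T x, y⟫_ℝ = ⟪x, T y⟫_ℝ) (x y : E) : ⟪green T hpos x, y⟫_ℝ = ⟪x, green T hpos y⟫_ℝ := by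
  rw [show ⟪green T hpos x, y⟫_ℝ = ⟪green T hpos x, T (green T hpos y)⟫_ℝ by rw [apply_green],
    show ⟪x, green T hpos y⟫_ℝ = ⟪T (green T hpos x), green T hpos y⟫_ℝ by rw [apply_green], hsymm]

end Green

/-! ## §2 `G₁ = (Δ₁ + DRD* + aQ*Q)⁻¹`, `(QG₁Q*)⁻¹` and `H₁ = G₁Q*(QG₁Q*)⁻¹` CONSTRUCTED from the positivity hypothesis -/

section Operators

variable [FiniteDimensional ℝ E] {F : Type*} [NormedAddCommGroup F] [InnerProductSpace ℝ F] {S : Type*} [AddCommGroup S]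
  [Module ℝ S] {Δ : E →ₗ[ℝ] E} {D : S →ₗ[ℝ] E} {R : S →ₗ[ℝ] S} {Dstar : E →ₗ[ℝ] S} {Q : E →ₗ[ℝ] F} {Qadj : F →ₗ[ℝ] E} {a : ℝ}

/-- **`G₁ := (Δ₁ + DRD* + aQ*Q)⁻¹`** ([B11] p. 294, (110), (117) *«By Theorem 3.13 of [5]»*; [B9] (3.129)) — `green` of lit-balaban's
`B11Eq127EulerLagrange.laplaceA Δ₁ D R D* Q Q* a`, under the displayed positivity of `Δ_{1,a}` ([B9] Thm 3.11: *«the operators Δ′_a, G′,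
(Q′G′²Q′*)⁻¹, Δ_a, G are positive definite»*). [cite: Balaban1985Variational, (110) p.294; Balaban1985BackgroundPropagators, Thm 3.11 p.416] -/
def G1 (Δ : E →ₗ[ℝ] E) (D : S →ₗ[ℝ] E) (R : S →ₗ[ℝ] S) (Dstar : E →ₗ[ℝ] S) (Q : E →ₗ[ℝ] F) (Qadj : F →ₗ[ℝ] E) (a : ℝ)
    (hpos : ∀ x : E, x ≠ 0 → 0 < ⟪x, laplaceA Δ D R Dstar Q Qadj a x⟫_ℝ) : E →ₗ[ℝ] E :=
  green (laplaceA Δ D R Dstar Q Qadj a) hpos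

variable (hpos : ∀ x : E, x ≠ 0 → 0 < ⟪x, laplaceA Δ D R Dstar Q Qadj a x⟫_ℝ)

/-- **`Δ_{1,a}(G₁x) = x`** — the hypothesis `hΔG` of `B11Eq129Minimizer` / `B11Eq101Translation`, DISCHARGED BY CONSTRUCTION.
[cite: Balaban1985Variational, (110) p.294] -/
theorem laplaceA_G1 (x : E) : laplaceA Δ D R Dstar Q Qadj a (G1 Δ D R Dstar Q Qadj a hpos x) = x := apply_green hpos x

/-- `G₁(Δ_{1,a}x) = x`. [cite: Balaban1985Variational, (110) p.294] -/
theorem G1_laplaceA (x : E) : G1 Δ D R Dstar Q Qadj a hpos (laplaceA Δ D R Dstar Q Qadj a x) = x := green_apply hpos x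

/-- `G₁` is positive definite. [cite: Balaban1985BackgroundPropagators, Thm 3.11 p.416] -/
theorem inner_G1_pos (x : E) (hx : x ≠ 0) : 0 < ⟪x, G1 Δ D R Dstar Q Qadj a hpos x⟫_ℝ := inner_green_pos hpos x hx

/-- **`K := QG₁Q*` is positive definite when `Q*` is injective** (= `Q` onto, `B9Eq319Onto`): `⟨y, QG₁Q*y⟩ = ⟨Q*y, G₁Q*y⟩ > 0` for `y ≠ 0` —
the «obvious» positivity of `(QG₁Q*)⁻¹`-type operators of [B9] Thm 3.11, here PROVED from that of `G₁` and the adjointness `⟨Qx, y⟩ = ⟨x, Q*y⟩`.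
[cite: Balaban1985BackgroundPropagators, Thm 3.11 p.416; Balaban1984PropagatorsI, p.25] -/
theorem inner_K_pos (hadj : ∀ (x : E) (y : F), ⟪Q x, y⟫_ℝ = ⟪x, Qadj y⟫_ℝ) (hQadj : Function.Injective Qadj) (y : F) (hy : y ≠ 0) :
    0 < ⟪y, (Q ∘ₗ G1 Δ D R Dstar Q Qadj a hpos ∘ₗ Qadj) y⟫_ℝ := by
  have hQy : Qadj y ≠ 0 := fun h => hy (hQadj (by rw [h, map_zero]))
  rw [LinearMap.comp_apply, LinearMap.comp_apply, real_inner_comm, hadj, real_inner_comm]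
  exact inner_G1_pos hpos (Qadj y) hQy

variable [FiniteDimensional ℝ F]

/-- **`(QG₁Q*)⁻¹`**, CONSTRUCTED (`green` of `QG₁Q*`). [cite: Balaban1985Variational, (45) p.285; Balaban1985BackgroundPropagators, Thm 3.11 p.416] -/
def Kinv (hadj : ∀ (x : E) (y : F), ⟪Q x, y⟫_ℝ = ⟪x, Qadj y⟫_ℝ) (hQadj : Function.Injective Qadj) : F →ₗ[ℝ] F :=
  green (Q ∘ₗ G1 Δ D R Dstar Q Qadj a hpos ∘ₗ Qadj) (inner_K_pos hpos hadj hQadj)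

/-- **`QG₁Q*(QG₁Q*)⁻¹ y = y`** — the hypothesis `hK` of `B11Eq129Minimizer.constraint_hOp` / `hOp_mem`, DISCHARGED BY CONSTRUCTION.
[cite: Balaban1985Variational, (45) p.285] -/
theorem hK_holds (hadj : ∀ (x : E) (y : F), ⟪Q x, y⟫_ℝ = ⟪x, Qadj y⟫_ℝ) (hQadj : Function.Injective Qadj) (y : F) :
    Q (G1 Δ D R Dstar Q Qadj a hpos (Qadj (Kinv hpos hadj hQadj y))) = y := by
  have h := apply_green (inner_K_pos hpos hadj hQadj) y
  unfold Kinv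
  simpa only [LinearMap.comp_apply] using h

/-- **`H₁ := G₁Q*(QG₁Q*)⁻¹`** — lit-balaban's `B11Eq129Minimizer.hOp` AT THE CONSTRUCTED `G₁`, `(QG₁Q*)⁻¹`: the operator of [B11] (45)/(103)
(*«The operators Δ, Q and R define the operator H … a minimum of the quadratic form ½⟨A, ΔA⟩ under the restrictions L^jηQ_jA = B on Λ_j,
RD*A = 0»*, p. 285) as an OBJECT determined by the printed operators `Δ₁, D, R, D*, Q, Q*, a` and two displayed facts (positivity of
`Δ_{1,a}`, injectivity of `Q*`). [cite: Balaban1985Variational, (45) p.285, (103) p.293] -/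
def H1 (hadj : ∀ (x : E) (y : F), ⟪Q x, y⟫_ℝ = ⟪x, Qadj y⟫_ℝ) (hQadj : Function.Injective Qadj) : F →ₗ[ℝ] E :=
  G1 Δ D R Dstar Q Qadj a hpos ∘ₗ Qadj ∘ₗ Kinv hpos hadj hQadj

/-- `H₁ b = hOp G₁ Q* (QG₁Q*)⁻¹ b` — the identification with lit-balaban's `hOp` BY `rfl`. [cite: Balaban1985Variational, (45) p.285] -/
theorem H1_apply (hadj : ∀ (x : E) (y : F), ⟪Q x, y⟫_ℝ = ⟪x, Qadj y⟫_ℝ) (hQadj : Function.Injective Qadj) (b : F) :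
    H1 hpos hadj hQadj b = hOp (G1 Δ D R Dstar Q Qadj a hpos) Qadj (Kinv hpos hadj hQadj) b := rfl

/-- **(45), first member: `Q(H₁b) = b`** — `B11Eq129Minimizer.constraint_hOp` with its hypothesis discharged. [cite: Balaban1985Variational, (45) p.285] -/
theorem Q_H1 (hadj : ∀ (x : E) (y : F), ⟪Q x, y⟫_ℝ = ⟪x, Qadj y⟫_ℝ) (hQadj : Function.Injective Qadj) (b : F) : Q (H1 hpos hadj hQadj b) = b :=
  constraint_hOp (hK_holds hpos hadj hQadj) b

/-- `H₁` is injective (a right inverse of `Q`). [cite: Balaban1985Variational, (45) p.285] -/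
theorem H1_injective (hadj : ∀ (x : E) (y : F), ⟪Q x, y⟫_ℝ = ⟪x, Qadj y⟫_ℝ) (hQadj : Function.Injective Qadj) :
    Function.Injective (H1 hpos hadj hQadj) :=
  Function.LeftInverse.injective (g := Q) (Q_H1 hpos hadj hQadj)

/-- **`Δ_{1,a}(H₁b) = Q*(QG₁Q*)⁻¹b ∈ range Q*`** — whence «⟨δA′, Δ₁H₁B⟩ = 0» for `QδA′ = 0` (`B11Eq129Minimizer.inner_delta_hOp_eq_zero`,
`B11Eq101Translation.inner_delta1_H1_eq_zero`, hypotheses discharged). [cite: Balaban1985Variational, p.293, (129) p.297] -/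
theorem laplaceA_H1 (hadj : ∀ (x : E) (y : F), ⟪Q x, y⟫_ℝ = ⟪x, Qadj y⟫_ℝ) (hQadj : Function.Injective Qadj) (b : F) :
    laplaceA Δ D R Dstar Q Qadj a (H1 hpos hadj hQadj b) = Qadj (Kinv hpos hadj hQadj b) := by
  rw [H1, LinearMap.comp_apply, LinearMap.comp_apply, G1, apply_green]

/-- `⟨δ, Δ_{1,a}(H₁b)⟩ = 0` whenever `Qδ = 0`. [cite: Balaban1985Variational, p.293] -/
theorem inner_laplaceA_H1_eq_zero (hadj : ∀ (x : E) (y : F), ⟪Q x, y⟫_ℝ = ⟪x, Qadj y⟫_ℝ) (hQadj : Function.Injective Qadj) (b : F)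
    {δ : E} (hδ : Q δ = 0) : ⟪δ, laplaceA Δ D R Dstar Q Qadj a (H1 hpos hadj hQadj b)⟫_ℝ = 0 := by
  rw [laplaceA_H1, ← hadj, hδ, inner_zero_left]

end Operators

end Literature.MathematicalPhysics.QuantumFieldTheory.Balaban1983to89.B11Eq110GreenInverse

end
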